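import Literature.MathematicalPhysics.QuantumFieldTheory.Balaban1983to89.Beta.ExpKernelCalculus
import Literature.MathematicalPhysics.QuantumFieldTheory.Balaban1983to89.Beta.PolarizationSign

/-!
# Bałaban's renormalization group, β-function cell (an2, background-field route) — REFLECTION COVARIANCE OF THE RESOLVENT
HESSIAN KERNEL FROM REFLECTION COVARIANCE OF ITS INGREDIENTS (the structural half of the `hR` slot of the END corollaries),
and the DIFFERENCE-VARIABLE law it produces

HONEST FRAMING (page 1, verbatim programme rule). Discharging `FlowStep.BetaPertH` would make Bałaban's ultraviolet stability
UNCONDITIONAL — a real constructive-QFT result; it is NOT the continuum limit and NOT the Clay problem. This file discharges NOTHING of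
`BetaPertH`: it is kernel-checked [folklore] bookkeeping about the abstract resolvent Hessian kernel
`ExpKernelCalculus.hessKer A V W` (`= ½·tadpole A (W μ 0 ν z) − ½·bubble A (V μ 0) (V ν z)`), of which the typed one-step kernels
`OneStepResolventKernel.TOf` and the step-`j` kernels of the background-field route are instances. No statement of the manuscripts
under audit is used; the two `[cite]` tags below are LOCATORS of the printed law whose typed form is discussed, never hypotheses.

WHAT IS PROVED ([folklore], sorry-free).
* §1 LEG RELABELLINGS. A `LegMap D F` is a family of bijections `r a : Site D ≃ Site D` of the fine lattice, one per fibre index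
  `a : F` (leg type), with signs `s a ∈ ℝ`, `s a · s a = 1`; `refK Φ K x z a b := s a · s b · K (r a x) (r b z)` is the relabelled
  matrix kernel. (For the block-averaging systems the intended instance — NOT constructed here — is the single-axis lattice reflection
  `u ↦ εu − t_a e_α` with the leg-type dependent shifts `t_a` that make it map averaging CONTOURS to averaging contours, and the signs
  `ε_κ` of (5.7); the leg dependence of `t_a` is why a leg-indexed family of bijections, rather than one bijection, is needed.)
* §2 SCALAR LINEARITY of `comp`, `tr`, `bubble`, `tadpole` (unconditional).
* §3 RELABELLING IDENTITIES under the decay hypotheses that make the series absolutely convergent (the middle `tsum` of `comp` and the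
  `tsum` of `tr` are re-indexed leg by leg, which needs the finite fibre sum and the lattice sum to commute):
  `comp (refK Φ A) (refK Φ K) = refK Φ (comp A K)`, `tr (refK Φ M) = tr M`, hence `bubble`/`tadpole` are INVARIANT under the
  simultaneous relabelling of all their arguments (`bubble_refK`, `tadpole_refK`).
* §4 **COVARIANCE OF THE HESSIAN** (`hess_refl`): if the resolvent is relabelling-invariant (`refK Φ A = A`), and the vertex families
  transform under a map `ρ μ : Site D → Site D` of the coarse bond base points with signs `σ μ` —
  `V μ (ρ μ y) = σ μ • refK Φ (V μ y)`, `W μ (ρ μ y) ν (ρ ν y′) = (σ μ σ ν) • refK Φ (W μ y ν y′)` — then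
  `hess A V W μ (ρ μ y) ν (ρ ν y′) = σ μ σ ν · hess A V W μ y ν y′`. The maps `Φ`, `ρ`, `σ` are ABSTRACT: the reflection geometry of
  the block systems enters only when the three hypotheses are verified for concrete `A`, `V`, `W` (not done here; for the typed KKT
  resolvent `OneStepResolventKernel.KInv` this needs the uniqueness / symmetry of the decaying KKT solution, recorded as NOT proved in
  `KKTFluctuationKernel`).
* §5 **THE DIFFERENCE-VARIABLE LAW** (`hessKer_refl`): with, in addition, block-translation covariance (`BlockCovariant`, so that
  `hess μ y ν y′ = hessKer μ ν (y′ − y)`, `ExpKernelCalculus.hess_eq_hessKer`) and `ρ` the affine bond map of the single-axis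
  reflection of axis `α`, `bondRefl α c μ y := εy − (c + [μ = α]) e_α` (any common offset `c`), `σ := reflSign α`:
  `hessKer A V W μ ν (εz + [μ=α]e_α − [ν=α]e_α) = ε_μ ε_ν · hessKer A V W μ ν z`.
  ORIENTATION REMARK (the point of §5). The typed predicate `PolarizationSign.AxisReflectionCovariant P` reads
  `P μ ν (εz − [μ=α]e_α + [ν=α]e_α) = ε_μ ε_ν P μ ν z` — the printed (5.7) in the printed difference variable `z = x − y` of (5.8)
  (first index at `x`: (5.4) puts `μ` on the bond `⟨x, x + e_μ⟩`). The kernel `hessKer μ ν z` carries `z = y′ − y`, the base point of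
  the SECOND bond (index `ν`) minus that of the FIRST (`hess_eq_hessKer`). Accordingly reflection-covariant ingredients yield, for
  `hessKer`, the law of §5 with the unit shifts' signs INTERCHANGED — which is `AxisReflectionCovariant` of the flipped kernel
  `z ↦ hessKer μ ν (−z)` (cf. the equivalence `OneStepKernelFamily.axisReflectionCovariant_flipK_iff`). The two laws are not
  interchangeable on a given kernel: both together force the off-diagonal channels to be `2e_α`-periodic, hence zero for decaying
  kernels. Nothing here asserts either law for Bałaban's kernels.

DEPENDENCES. `Beta.ExpKernelCalculus` (kernels, `comp`/`tr`/`bubble`/`tadpole`, `hess`/`hessKer`, `BlockCovariant`, decay classes and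
their summability lemmas), `Beta.PolarizationSign` (`axisReflect`, `reflSign`, the printed predicates), `B6BondElimination` (`unitVec`).

References (locators for orientation only; no printed statement is used as a hypothesis):
* [B12] T. Bałaban, Renormalization group approach to lattice gauge field theories. I, Comm. Math. Phys. 109 (1987) 249–301,
  (5.4), (5.7), (5.8) p. 293. [cite: Balaban1987RG1]
-/

open Finset
open scoped BigOperators
open Literature.MathematicalPhysics.QuantumFieldTheory.Balaban1983to89
open Literature.MathematicalPhysics.QuantumFieldTheory.Balaban1983to89.Beta
open B12Sec2to5 (l1 l1_nonneg)
open B6BondElimination (unitVec unitVec_apply)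
open PolarizationSign (axisReflect axisReflect_apply reflSign AxisReflectionCovariant)
open ExpKernelCalculus (Decays BiLoc comp tr bubble tadpole VertexFamily VertexFamily₂ hess hessKer BlockCovariant
  hess_eq_hessKer summable_exp_shift summable_exp_shift' biLoc_comp_decays biLoc_comp_biLoc)

namespace Literature.MathematicalPhysics.QuantumFieldTheory.Balaban1983to89.Beta.KernelReflection

noncomputable section

variable {D : ℕ} {F : Type*} [Fintype F]

/-! ## §1 Leg relabellings and the relabelled kernel -/

/-- LEG RELABELLING DATA: one bijection of the fine lattice per fibre index (leg type) and a sign per leg type with `s a · s a = 1`.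
[folklore] -/
structure LegMap (D : ℕ) (F : Type*) where
  /-- the bijection of the fine lattice `ℤ^D` acting on legs of type `a` -/
  r : F → (Fin D → ℤ) ≃ (Fin D → ℤ)
  /-- the sign attached to legs of type `a` -/
  s : F → ℝ
  /-- signs square to one -/
  s_mul_s : ∀ a, s a * s a = 1

omit [Fintype F] in
/-- THE RELABELLED KERNEL `(Φ·K)(x, z)_{ab} := s_a s_b K(r_a x, r_b z)_{ab}`. [folklore] -/
def refK (Φ : LegMap D F) (K : ExpKernelCalculus.MKer D F) : ExpKernelCalculus.MKer D F := fun x z a b => Φ.s a * Φ.s b * K (Φ.r a x) (Φ.r b z) a b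

omit [Fintype F] in
/-- Entries of the relabelled kernel. [folklore] -/
@[simp] theorem refK_apply (Φ : LegMap D F) (K : ExpKernelCalculus.MKer D F) (x z : Fin D → ℤ) (a b : F) :
    refK Φ K x z a b = Φ.s a * Φ.s b * K (Φ.r a x) (Φ.r b z) a b := rfl

/-! ## §2 Scalar linearity of composition, trace, bubble and tadpole -/

/-- `comp (c • K) L = c • comp K L`. [folklore] -/
theorem comp_smul_left (c : ℝ) (K L : ExpKernelCalculus.MKer D F) : comp (c • K) L = c • comp K L := by
  funext x z a b
  show (∑' y, ∑ f, (c • K) x y a f * L y z f b) = c * ∑' y, ∑ f, K x y a f * L y z f b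
  rw [← tsum_mul_left]
  refine tsum_congr fun y => ?_
  rw [Finset.mul_sum]
  refine Finset.sum_congr rfl fun f _ => ?_
  simp only [Pi.smul_apply, smul_eq_mul]
  ring

/-- `comp K (c • L) = c • comp K L`. [folklore] -/
theorem comp_smul_right (c : ℝ) (K L : ExpKernelCalculus.MKer D F) : comp K (c • L) = c • comp K L := by
  funext x z a b
  show (∑' y, ∑ f, K x y a f * (c • L) y z f b) = c * ∑' y, ∑ f, K x y a f * L y z f b
  rw [← tsum_mul_left]
  refine tsum_congr fun y => ?_
  rw [Finset.mul_sum]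
  refine Finset.sum_congr rfl fun f _ => ?_
  simp only [Pi.smul_apply, smul_eq_mul]
  ring

/-- `tr (c • K) = c · tr K`. [folklore] -/
theorem tr_smul (c : ℝ) (K : ExpKernelCalculus.MKer D F) : tr (c • K) = c * tr K := by
  show (∑' x, ∑ a, (c • K) x x a a) = c * ∑' x, ∑ a, K x x a a
  rw [← tsum_mul_left]
  refine tsum_congr fun x => ?_
  rw [Finset.mul_sum]
  refine Finset.sum_congr rfl fun a _ => ?_
  simp only [Pi.smul_apply, smul_eq_mul]

/-- `bubble A (c • V) W = c · bubble A V W`. [folklore] -/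
theorem bubble_smul_left (c : ℝ) (A V W : ExpKernelCalculus.MKer D F) : bubble A (c • V) W = c * bubble A V W := by
  unfold ExpKernelCalculus.bubble
  rw [comp_smul_right, comp_smul_left, tr_smul]

/-- `bubble A V (c • W) = c · bubble A V W`. [folklore] -/
theorem bubble_smul_right (c : ℝ) (A V W : ExpKernelCalculus.MKer D F) : bubble A V (c • W) = c * bubble A V W := by
  unfold ExpKernelCalculus.bubble
  rw [comp_smul_right, comp_smul_right, tr_smul]

/-- `tadpole A (c • W₂) = c · tadpole A W₂`. [folklore] -/
theorem tadpole_smul (c : ℝ) (A W₂ : ExpKernelCalculus.MKer D F) : tadpole A (c • W₂) = c * tadpole A W₂ := by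
  unfold ExpKernelCalculus.tadpole
  rw [comp_smul_right, tr_smul]

/-! ## §3 Relabelling identities (absolutely convergent series re-indexed leg by leg) -/

omit [Fintype F] in
/-- Slice summability, decaying ∘ bi-localised: for each middle leg type `f`, `y ↦ A(x,y)_{af} K(y,z)_{fb}` is summable. [folklore] -/
theorem summable_slice {A K : ExpKernelCalculus.MKer D F} {C C' δ : ℝ} (hA : Decays A C δ) {p q : Fin D → ℤ} (hK : BiLoc K p q C' δ) (hδ : 0 < δ)
    (x z : Fin D → ℤ) (a f b : F) : Summable fun y : Fin D → ℤ => A x y a f * K y z f b := by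
  refine Summable.of_norm_bounded ((summable_exp_shift hδ x).mul_left (C * C')) (fun y => ?_)
  rw [Real.norm_eq_abs, abs_mul]
  have h1 := hA x y a f
  have h2 := hK y z f b
  have hC' : 0 ≤ C' := by
    have := (abs_nonneg _).trans h2
    exact nonneg_of_mul_nonneg_left this (Real.exp_pos _)
  have h3 : |K y z f b| ≤ C' := by
    refine h2.trans ?_
    have : Real.exp (-δ * (l1 (y - p) + l1 (z - q))) ≤ 1 :=
      Real.exp_le_one_iff.mpr (by nlinarith [l1_nonneg (y - p), l1_nonneg (z - q), hδ.le])
    calc C' * Real.exp (-δ * (l1 (y - p) + l1 (z - q))) ≤ C' * 1 := mul_le_mul_of_nonneg_left this hC'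
      _ = C' := mul_one _
  calc |A x y a f| * |K y z f b| ≤ (C * Real.exp (-δ * l1 (x - y))) * C' :=
        mul_le_mul h1 h3 (abs_nonneg _) ((abs_nonneg _).trans h1)
    _ = C * C' * Real.exp (-δ * l1 (x - y)) := by ring

omit [Fintype F] in
/-- Slice summability, bi-localised ∘ bi-localised. [folklore] -/
theorem summable_slice₂ {K K' : ExpKernelCalculus.MKer D F} {C C' δ : ℝ} {p p' q' q : Fin D → ℤ} (hK : BiLoc K p p' C δ) (hK' : BiLoc K' q' q C' δ)
    (hδ : 0 < δ) (x z : Fin D → ℤ) (a f b : F) : Summable fun y : Fin D → ℤ => K x y a f * K' y z f b := by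
  refine Summable.of_norm_bounded ((summable_exp_shift' hδ p').mul_left (C * C')) (fun y => ?_)
  rw [Real.norm_eq_abs, abs_mul]
  have h1 := hK x y a f
  have h2 := hK' y z f b
  have hC : 0 ≤ C := by
    have := (abs_nonneg _).trans h1
    exact nonneg_of_mul_nonneg_left this (Real.exp_pos _)
  have hC' : 0 ≤ C' := by
    have := (abs_nonneg _).trans h2
    exact nonneg_of_mul_nonneg_left this (Real.exp_pos _)
  have h1' : |K x y a f| ≤ C * Real.exp (-δ * l1 (y - p')) := by
    refine h1.trans (mul_le_mul_of_nonneg_left ?_ hC)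
    exact Real.exp_le_exp.mpr (by nlinarith [l1_nonneg (x - p), l1_nonneg (y - p'), hδ.le])
  have h2' : |K' y z f b| ≤ C' := by
    refine h2.trans ?_
    have : Real.exp (-δ * (l1 (y - q') + l1 (z - q))) ≤ 1 :=
      Real.exp_le_one_iff.mpr (by nlinarith [l1_nonneg (y - q'), l1_nonneg (z - q), hδ.le])
    calc C' * Real.exp (-δ * (l1 (y - q') + l1 (z - q))) ≤ C' * 1 := mul_le_mul_of_nonneg_left this hC'
      _ = C' := mul_one _
  calc |K x y a f| * |K' y z f b| ≤ (C * Real.exp (-δ * l1 (y - p'))) * C' :=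
        mul_le_mul h1' h2' (abs_nonneg _) ((abs_nonneg _).trans h1')
    _ = C * C' * Real.exp (-δ * l1 (y - p')) := by ring

omit [Fintype F] in
/-- Slice summability of the trace series of a bi-localised kernel, one leg type at a time. [folklore] -/
theorem summable_trSlice {M : ExpKernelCalculus.MKer D F} {C δ : ℝ} {p q : Fin D → ℤ} (hM : BiLoc M p q C δ) (hδ : 0 < δ) (a : F) :
    Summable fun x : Fin D → ℤ => M x x a a := by
  refine Summable.of_norm_bounded ((summable_exp_shift' hδ p).mul_left C) (fun x => ?_)
  rw [Real.norm_eq_abs]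
  have h1 := hM x x a a
  have hC : 0 ≤ C := by
    have := (abs_nonneg _).trans h1
    exact nonneg_of_mul_nonneg_left this (Real.exp_pos _)
  refine h1.trans (mul_le_mul_of_nonneg_left ?_ hC)
  exact Real.exp_le_exp.mpr (by nlinarith [l1_nonneg (x - p), l1_nonneg (x - q), hδ.le])

/-- **COMPOSITION COMMUTES WITH RELABELLING** (given slice summability): `(Φ·A) ∘ (Φ·K) = Φ·(A ∘ K)` — the middle leg's sign squares
to one and its lattice sum is re-indexed by the middle leg's bijection, leg type by leg type. [folklore] -/
theorem comp_refK (Φ : LegMap D F) {A K : ExpKernelCalculus.MKer D F} (hs : ∀ x z a f b, Summable fun y : Fin D → ℤ => A x y a f * K y z f b) :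
    comp (refK Φ A) (refK Φ K) = refK Φ (comp A K) := by
  funext x z a b
  have hsf : ∀ f, Summable fun y : Fin D → ℤ => A (Φ.r a x) y a f * K y (Φ.r b z) f b := fun f => hs _ _ _ _ _
  have hsf' : ∀ f, Summable fun y : Fin D → ℤ => A (Φ.r a x) (Φ.r f y) a f * K (Φ.r f y) (Φ.r b z) f b :=
    fun f => (Φ.r f).summable_iff.2 (hsf f)
  calc comp (refK Φ A) (refK Φ K) x z a b
      = ∑' y, ∑ f, (Φ.s a * Φ.s f * A (Φ.r a x) (Φ.r f y) a f) * (Φ.s f * Φ.s b * K (Φ.r f y) (Φ.r b z) f b) := rfl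
    _ = ∑' y, Φ.s a * Φ.s b * ∑ f, A (Φ.r a x) (Φ.r f y) a f * K (Φ.r f y) (Φ.r b z) f b := by
        refine tsum_congr fun y => ?_
        rw [Finset.mul_sum]
        refine Finset.sum_congr rfl fun f _ => ?_
        have hf := Φ.s_mul_s f
        calc (Φ.s a * Φ.s f * A (Φ.r a x) (Φ.r f y) a f) * (Φ.s f * Φ.s b * K (Φ.r f y) (Φ.r b z) f b)
            = (Φ.s f * Φ.s f) * (Φ.s a * Φ.s b * (A (Φ.r a x) (Φ.r f y) a f * K (Φ.r f y) (Φ.r b z) f b)) := by ring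
          _ = Φ.s a * Φ.s b * (A (Φ.r a x) (Φ.r f y) a f * K (Φ.r f y) (Φ.r b z) f b) := by rw [hf, one_mul]
    _ = Φ.s a * Φ.s b * ∑' y, ∑ f, A (Φ.r a x) (Φ.r f y) a f * K (Φ.r f y) (Φ.r b z) f b := tsum_mul_left
    _ = Φ.s a * Φ.s b * ∑' y, ∑ f, A (Φ.r a x) y a f * K y (Φ.r b z) f b := by
        congr 1
        rw [Summable.tsum_finsetSum (fun f _ => hsf' f), Summable.tsum_finsetSum (fun f _ => hsf f)]
        exact Finset.sum_congr rfl fun f _ => (Φ.r f).tsum_eq (fun y => A (Φ.r a x) y a f * K y (Φ.r b z) f b)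
    _ = refK Φ (comp A K) x z a b := rfl

/-- **THE TRACE IS RELABELLING-INVARIANT** (given slice summability): `tr (Φ·M) = tr M`. [folklore] -/
theorem tr_refK (Φ : LegMap D F) {M : ExpKernelCalculus.MKer D F} (hs : ∀ a, Summable fun x : Fin D → ℤ => M x x a a) : tr (refK Φ M) = tr M := by
  have hs' : ∀ a, Summable fun x : Fin D → ℤ => M (Φ.r a x) (Φ.r a x) a a := fun a => (Φ.r a).summable_iff.2 (hs a)
  calc tr (refK Φ M) = ∑' x, ∑ a, Φ.s a * Φ.s a * M (Φ.r a x) (Φ.r a x) a a := rfl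
    _ = ∑' x, ∑ a, M (Φ.r a x) (Φ.r a x) a a := by
        refine tsum_congr fun x => Finset.sum_congr rfl fun a _ => ?_
        rw [Φ.s_mul_s, one_mul]
    _ = ∑ a, ∑' x, M (Φ.r a x) (Φ.r a x) a a := Summable.tsum_finsetSum (fun a _ => hs' a)
    _ = ∑ a, ∑' x, M x x a a := Finset.sum_congr rfl fun a _ => (Φ.r a).tsum_eq (fun x => M x x a a)
    _ = tr M := (Summable.tsum_finsetSum (fun a _ => hs a)).symm

/-- **THE BUBBLE IS RELABELLING-INVARIANT**: `bubble (Φ·A) (Φ·V) (Φ·W) = bubble A V W` for a decaying `A` and vertex kernels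
bi-localised at `(p,p)`, `(q,q)`. [folklore] -/
theorem bubble_refK (Φ : LegMap D F) {A V W : ExpKernelCalculus.MKer D F} {C Cv Cw δ : ℝ} (hA : Decays A C δ) {p q : Fin D → ℤ}
    (hV : BiLoc V p p Cv δ) (hW : BiLoc W q q Cw δ) (hδ : 0 < δ) :
    bubble (refK Φ A) (refK Φ V) (refK Φ W) = bubble A V W := by
  unfold ExpKernelCalculus.bubble
  have h1 := biLoc_comp_decays hA hV (show 0 ≤ δ / 2 by linarith) (show δ / 2 < δ by linarith)
  have h2 := biLoc_comp_decays hA hW (show 0 ≤ δ / 2 by linarith) (show δ / 2 < δ by linarith)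
  have h3 := biLoc_comp_biLoc h1 h2 (by linarith : 0 < δ / 2)
  rw [comp_refK Φ (summable_slice hA hV hδ), comp_refK Φ (summable_slice hA hW hδ),
    comp_refK Φ (summable_slice₂ h1 h2 (by linarith : 0 < δ / 2))]
  exact tr_refK Φ (summable_trSlice h3 (by linarith))

/-- **THE TADPOLE IS RELABELLING-INVARIANT**: `tadpole (Φ·A) (Φ·W₂) = tadpole A W₂`. [folklore] -/
theorem tadpole_refK (Φ : LegMap D F) {A W₂ : ExpKernelCalculus.MKer D F} {C Cw δ : ℝ} (hA : Decays A C δ) {p q : Fin D → ℤ} (hW : BiLoc W₂ p q Cw δ)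
    (hδ : 0 < δ) : tadpole (refK Φ A) (refK Φ W₂) = tadpole A W₂ := by
  unfold ExpKernelCalculus.tadpole
  have h1 := biLoc_comp_decays hA hW (show 0 ≤ δ / 2 by linarith) (show δ / 2 < δ by linarith)
  rw [comp_refK Φ (summable_slice hA hW hδ)]
  exact tr_refK Φ (summable_trSlice h1 (by linarith))

/-! ## §4 Covariance of the Hessian under a symmetry of its ingredients -/

/-- **COVARIANCE OF THE RESOLVENT HESSIAN.** If the resolvent is relabelling-invariant (`Φ·A = A`) and the vertex families at the
image bonds are the relabelled vertex families up to the bond signs `σ`, then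
`hess μ (ρ μ y) ν (ρ ν y′) = σ μ σ ν · hess μ y ν y′`. [folklore] -/
theorem hess_refl (Φ : LegMap D F) {A : ExpKernelCalculus.MKer D F} {V : Fin D → (Fin D → ℤ) → ExpKernelCalculus.MKer D F}
    {W : Fin D → (Fin D → ℤ) → Fin D → (Fin D → ℤ) → ExpKernelCalculus.MKer D F} {C Cv Cw δ : ℝ} {N : ℕ}
    (hA : Decays A C δ) (hV : VertexFamily V N Cv δ) (hW : VertexFamily₂ W N Cw δ) (hδ : 0 < δ) (hAr : refK Φ A = A)
    (ρ : Fin D → (Fin D → ℤ) → (Fin D → ℤ)) (σ : Fin D → ℝ) (hVr : ∀ μ y, V μ (ρ μ y) = σ μ • refK Φ (V μ y))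
    (hWr : ∀ μ y ν y', W μ (ρ μ y) ν (ρ ν y') = (σ μ * σ ν) • refK Φ (W μ y ν y'))
    (μ : Fin D) (y : Fin D → ℤ) (ν : Fin D) (y' : Fin D → ℤ) :
    hess A V W μ (ρ μ y) ν (ρ ν y') = σ μ * σ ν * hess A V W μ y ν y' := by
  unfold ExpKernelCalculus.hess
  rw [hWr, hVr, hVr, tadpole_smul, bubble_smul_left, bubble_smul_right]
  conv_lhs => rw [← hAr]
  rw [tadpole_refK Φ hA (hW μ y ν y') hδ, bubble_refK Φ hA (hV μ y) (hV ν y') hδ]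
  ring

/-! ## §5 The single-axis reflection of the coarse bonds and the difference-variable law -/

/-- THE AFFINE BOND MAP of the reflection of axis `α` with common offset `c`: the base point `y` of a `μ`-bond goes to
`εy − (c + [μ = α]) e_α` (a reflected `α`-bond is re-based at its other endpoint; the common offset `c` is conventional — for the
blocking of factor `N` read from the fine lattice the block-preserving choice is `c = 1`). [folklore] -/
def bondRefl (α : Fin D) (c : ℤ) (μ : Fin D) (y : Fin D → ℤ) : Fin D → ℤ :=
  axisReflect α y - (c + if μ = α then 1 else 0) • unitVec α

omit [Fintype F] in
/-- The difference of two image base points: `bondRefl α c ν y′ − bondRefl α c μ y = ε(y′ − y) + [μ=α]e_α − [ν=α]e_α`. [folklore] -/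
theorem bondRefl_sub (α : Fin D) (c : ℤ) (μ ν : Fin D) (y y' : Fin D → ℤ) :
    bondRefl α c ν y' - bondRefl α c μ y
      = axisReflect α (y' - y) + (if μ = α then unitVec α else 0) - (if ν = α then unitVec α else 0) := by
  funext i
  unfold bondRefl
  simp only [Pi.sub_apply, Pi.add_apply, Pi.smul_apply, axisReflect_apply, smul_eq_mul]
  by_cases hi : i = α
  · subst hi
    by_cases hμ : μ = i <;> by_cases hν : ν = i <;> simp [hμ, hν, unitVec_apply] <;> ring
  · have h0 : unitVec α i = 0 := by simp [unitVec_apply, hi]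
    by_cases hμ : μ = α <;> by_cases hν : ν = α <;> simp [hμ, hν, hi, h0]

/-- **THE DIFFERENCE-VARIABLE LAW OF A REFLECTION-COVARIANT RESOLVENT HESSIAN.** Under block-translation covariance and the three
covariance hypotheses of `hess_refl` for the bond map `bondRefl α c` with signs `reflSign α`:
`hessKer μ ν (εz + [μ=α]e_α − [ν=α]e_α) = ε_μ ε_ν · hessKer μ ν z` — the printed (5.7)/(5.8) law with the unit shifts' signs
interchanged, i.e. `PolarizationSign.AxisReflectionCovariant` of the flipped kernel `z ↦ hessKer μ ν (−z)` (module docstring,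
ORIENTATION REMARK). [folklore] (Locator of the printed law, orientation only: [cite: Balaban1987RG1, (5.7)-(5.8) p.293].) -/
theorem hessKer_refl (Φ : LegMap D F) {A : ExpKernelCalculus.MKer D F} {V : Fin D → (Fin D → ℤ) → ExpKernelCalculus.MKer D F}
    {W : Fin D → (Fin D → ℤ) → Fin D → (Fin D → ℤ) → ExpKernelCalculus.MKer D F} {C Cv Cw δ : ℝ} {N : ℕ}
    (hA : Decays A C δ) (hV : VertexFamily V N Cv δ) (hW : VertexFamily₂ W N Cw δ) (hδ : 0 < δ) (hcov : BlockCovariant A V W N)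
    (hAr : refK Φ A = A) (α : Fin D) (c : ℤ)
    (hVr : ∀ μ y, V μ (bondRefl α c μ y) = reflSign α μ • refK Φ (V μ y))
    (hWr : ∀ μ y ν y', W μ (bondRefl α c μ y) ν (bondRefl α c ν y') = (reflSign α μ * reflSign α ν) • refK Φ (W μ y ν y'))
    (μ ν : Fin D) (z : Fin D → ℤ) :
    hessKer A V W μ ν (axisReflect α z + (if μ = α then unitVec α else 0) - (if ν = α then unitVec α else 0))
      = reflSign α μ * reflSign α ν * hessKer A V W μ ν z := by
  have h := hess_refl Φ hA hV hW hδ hAr (bondRefl α c) (reflSign α) hVr hWr μ 0 ν z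
  rw [hess_eq_hessKer hcov, hess_eq_hessKer hcov, sub_zero, bondRefl_sub, sub_zero] at h
  exact h

/-- The same law read through the flip `z ↦ −z`: the flipped kernel `P μ ν z := hessKer μ ν (−z)` satisfies the typed predicate
`PolarizationSign.AxisReflectionCovariant` verbatim. [folklore] -/
theorem axisReflectionCovariant_flip_hessKer {A : ExpKernelCalculus.MKer D F} {V : Fin D → (Fin D → ℤ) → ExpKernelCalculus.MKer D F}
    {W : Fin D → (Fin D → ℤ) → Fin D → (Fin D → ℤ) → ExpKernelCalculus.MKer D F} {C Cv Cw δ : ℝ} {N : ℕ}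
    (hA : Decays A C δ) (hV : VertexFamily V N Cv δ) (hW : VertexFamily₂ W N Cw δ) (hδ : 0 < δ) (hcov : BlockCovariant A V W N)
    (hAr : ∀ α : Fin D, ∃ Φα : LegMap D F, refK Φα A = A ∧ ∃ c : ℤ,
      (∀ μ y, V μ (bondRefl α c μ y) = reflSign α μ • refK Φα (V μ y)) ∧
      (∀ μ y ν y', W μ (bondRefl α c μ y) ν (bondRefl α c ν y') = (reflSign α μ * reflSign α ν) • refK Φα (W μ y ν y'))) :
    AxisReflectionCovariant (fun μ ν z => hessKer A V W μ ν (-z)) := by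
  intro α μ ν z
  obtain ⟨Φα, hA', c, hVr, hWr⟩ := hAr α
  have h := hessKer_refl Φα hA hV hW hδ hcov hA' α c hVr hWr μ ν (-z)
  have e : -(axisReflect α z - (if μ = α then unitVec α else 0) + (if ν = α then unitVec α else 0))
      = axisReflect α (-z) + (if μ = α then unitVec α else 0) - (if ν = α then unitVec α else 0) := by
    funext i
    simp only [Pi.neg_apply, Pi.sub_apply, Pi.add_apply, axisReflect_apply]
    by_cases hi : i = α <;> by_cases hμ : μ = α <;> by_cases hν : ν = α <;> simp [hi, hμ, hν, unitVec_apply] <;> ring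
  show hessKer A V W μ ν (-(axisReflect α z - (if μ = α then unitVec α else 0) + (if ν = α then unitVec α else 0)))
    = reflSign α μ * reflSign α ν * hessKer A V W μ ν (-z)
  rw [e]
  exact h

end

end Literature.MathematicalPhysics.QuantumFieldTheory.Balaban1983to89.Beta.KernelReflection
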